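import Literature.NumberTheory.Sieve.BombieriFriedlanderIwaniecSiegelWalfisz
import Literature.NumberTheory.Sieve.BombieriFriedlanderIwaniecBilinearProofs
import Literature.NumberTheory.LFunctions.SiegelWalfiszLiouville
import Literature.NumberTheory.LFunctions.SiegelWalfiszMoebiusProofs
import Literature.NumberTheory.Sieve.Polymath8aSmoothSiegelWalfisz
import Literature.NumberTheory.Sieve.DivisorBound
import HarnessLib

/-!
# Route `ChenParityOracleBLAP` — crux S1 = `HostParityFromBrick` (stmt-Parity-20045): hypothesis (A₂) for the Liouville function, tools

Support file for the prime half `K1 → K2 → HP1` of S1 (the unconditional Type-I input).  The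
Barban–Davenport–Halberstam theorem of the tree (`BombieriFriedlanderIwaniecTheorem0a_classic`,
BFI 1986 Theorem 0) is stated for sequences `β` satisfying BFI's Siegel–Walfisz hypothesis (A₂)
(`Literature.NumberTheory.Sieve.BFI.SiegelWalfiszHyp`).  Here (A₂) is PROVED for `β = λ`, the
Liouville function, at every scale `N ≥ 4` with divisor exponent `B = 2` and a family of constants
depending only on `A` (`siegelWalfiszHyp_liouville`): small moduli `k ≤ (log 2N)^{2A+2}` by the
Siegel–Walfisz theorem for `λ` (`SiegelWalfiszMoebius.liouville_progression`, PROVED in the tree)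
after removing the coprimality condition `(n, d) = 1` by Möbius inversion over `e ∣ d`
(`e ≤ √N` by Siegel–Walfisz at scale `N/e`, `e > √N` trivially); large moduli by the divisor bound
`φ(k) ≥ k/τ(k) ≫ k^{1/2}` (`BFI.abs_disc_le_large`); the absolute bound is converted to BFI's
relative form by `BFI.relative_of_absolute` (`‖λ‖² = #{n ∼ N} ≥ N/2`).

References: E. Bombieri, J. B. Friedlander, H. Iwaniec, Acta Math. 156 (1986), §1 (A₂)
[BombieriFriedlanderIwaniecActa1986]; H. L. Montgomery, R. C. Vaughan, *Multiplicative Number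
Theory I* (2007), §11.3 [MontgomeryVaughan2007].
-/

namespace Summit.Parity.GeneralizedHardyLittlewood.Theorems

open Finset Real
open scoped ArithmeticFunction.sigma
open ArithmeticFunction (liouville)
open Literature.NumberTheory.Sieve Literature.NumberTheory.Sieve.BFI

/-! ### Dyadic sums along multiples -/

/-- Reindexing the multiples of `e` in a dyadic range: for `e ≥ 1`, `N ≥ 0`,
`∑_{n ∼ N, e ∣ n, P(n)} f(n) = ∑_{m ∼ N/e, P(em)} f(em)`. -/
theorem sum_dyadic_filter_dvd_eq {N : ℝ} (hN : 0 ≤ N) {e : ℕ} (he : 1 ≤ e) (P : ℕ → Prop)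
    [DecidablePred P] (f : ℕ → ℝ) :
    ∑ n ∈ (dyadic N).filter (fun n => e ∣ n ∧ P n), f n =
      ∑ m ∈ (dyadic (N / e)).filter (fun m => P (e * m)), f (e * m) := by
  have he0 : (0 : ℝ) < e := by exact_mod_cast he
  have hNe : 0 ≤ N / e := div_nonneg hN he0.le
  have hinj : Set.InjOn (fun m : ℕ => e * m) ((dyadic (N / e)).filter (fun m => P (e * m)) : Set ℕ) :=
    fun a _ b _ h => Nat.eq_of_mul_eq_mul_left (by omega) h
  rw [← Finset.sum_image hinj]
  refine Finset.sum_congr ?_ fun _ _ => rfl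
  ext n
  simp only [Finset.mem_filter, Finset.mem_image, mem_dyadic hN, mem_dyadic hNe]
  constructor
  · rintro ⟨⟨h1, h2⟩, ⟨m, rfl⟩, hP⟩
    refine ⟨m, ⟨⟨?_, ?_⟩, hP⟩, rfl⟩
    · rw [div_lt_iff₀ he0]; push_cast at h1; linarith [mul_comm (m : ℝ) e]
    · rw [le_div_iff₀' he0] at *; push_cast at h2
      calc (m : ℝ) ≤ 2 * N / e := by rw [le_div_iff₀' he0]; linarith
        _ = 2 * (N / e) := by ring
  · rintro ⟨m, ⟨⟨h1, h2⟩, hP⟩, rfl⟩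
    refine ⟨⟨?_, ?_⟩, ⟨m, rfl⟩, hP⟩
    · push_cast; rw [div_lt_iff₀ he0] at h1; linarith [mul_comm (m : ℝ) e]
    · push_cast
      have : (m : ℝ) * e ≤ 2 * (N / e) * e := mul_le_mul_of_nonneg_right h2 he0.le
      rw [show 2 * (N / e) * e = 2 * N by field_simp] at this; linarith [mul_comm (m : ℝ) e]

/-! ### Liouville sums over a dyadic range in a residue class -/

/-- `|∑_{m ∼ M, m ≡ c (k)} λ(m)| ≤ |∑_{m ≤ 2M, m ≡ c} λ(m)| + |∑_{m ≤ M, m ≡ c} λ(m)|`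
(the dyadic range is a difference of two initial segments). -/
theorem abs_sum_dyadic_class_le {M : ℝ} (hM : 0 ≤ M) (k : ℕ) (c : ZMod k) :
    |∑ m ∈ (dyadic M).filter (fun m : ℕ => (m : ZMod k) = c), (liouville m : ℝ)| ≤
      |∑ m ∈ (Icc 1 ⌊2 * M⌋₊).filter (fun m : ℕ => (m : ZMod k) = c), (liouville m : ℝ)| +
        |∑ m ∈ (Icc 1 ⌊M⌋₊).filter (fun m : ℕ => (m : ZMod k) = c), (liouville m : ℝ)| := by
  have hle : ⌊M⌋₊ ≤ ⌊2 * M⌋₊ := Nat.floor_mono (by linarith)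
  set g : ℕ → ℝ := fun m => if (m : ZMod k) = c then (liouville m : ℝ) else 0 with hg
  have h1 : ∑ m ∈ (dyadic M).filter (fun m : ℕ => (m : ZMod k) = c), (liouville m : ℝ) =
      ∑ m ∈ Ioc ⌊M⌋₊ ⌊2 * M⌋₊, g m := by
    rw [dyadic_eq_Ioc hM, Finset.sum_filter]
  have hIoc : ∀ n : ℕ, Ioc 0 n = Icc 1 n := fun n => by
    ext m; simp only [Finset.mem_Ioc, Finset.mem_Icc]; omega
  have h2 : ∀ n : ℕ, ∑ m ∈ (Icc 1 n).filter (fun m : ℕ => (m : ZMod k) = c), (liouville m : ℝ) =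
      ∑ m ∈ Ioc 0 n, g m := by
    intro n; rw [Finset.sum_filter, hIoc]
  have h3 : ∑ m ∈ Ioc 0 ⌊M⌋₊, g m + ∑ m ∈ Ioc ⌊M⌋₊ ⌊2 * M⌋₊, g m = ∑ m ∈ Ioc 0 ⌊2 * M⌋₊, g m :=
    Finset.sum_Ioc_consecutive g (Nat.zero_le _) hle
  rw [h1, h2, h2]
  have : ∑ m ∈ Ioc ⌊M⌋₊ ⌊2 * M⌋₊, g m = ∑ m ∈ Ioc 0 ⌊2 * M⌋₊, g m - ∑ m ∈ Ioc 0 ⌊M⌋₊, g m := by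
    linarith
  rw [this]
  exact abs_sub _ _

/-- The discrepancy of a `±1`-sequence over a dyadic class against its coprime mean is at most
twice a uniform bound for its class sums: if `|∑_{m ∼ M, m ≡ c (k)} λ(m)| ≤ P` for all `c`, then
`|∑_{m ∼ M, m ≡ a (k)} λ(m) − φ(k)⁻¹ ∑_{m ∼ M, (m,k)=1} λ(m)| ≤ 2P`. -/
theorem abs_class_sub_mean_le {M : ℝ} {k : ℕ} (hk : 1 ≤ k) {P : ℝ}
    (hP : ∀ c : ZMod k, |∑ m ∈ (dyadic M).filter (fun m : ℕ => (m : ZMod k) = c), (liouville m : ℝ)| ≤ P)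
    (a : ZMod k) :
    |(∑ m ∈ (dyadic M).filter (fun m : ℕ => (m : ZMod k) = a), (liouville m : ℝ)) -
        (∑ m ∈ (dyadic M).filter (fun m : ℕ => m.Coprime k), (liouville m : ℝ)) / (Nat.totient k : ℝ)| ≤
      2 * P := by
  classical
  haveI : NeZero k := ⟨by omega⟩
  have hφ : (0 : ℝ) < Nat.totient k := by exact_mod_cast Nat.totient_pos.mpr hk
  have hP0 : 0 ≤ P := le_trans (abs_nonneg _) (hP a)
  -- the coprime sum is the sum over the unit classes
  have hcop : ∑ m ∈ (dyadic M).filter (fun m : ℕ => m.Coprime k), (liouville m : ℝ) =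
      ∑ b ∈ (Finset.univ : Finset (ZMod k)).filter (fun b => IsUnit b),
        ∑ m ∈ (dyadic M).filter (fun m : ℕ => (m : ZMod k) = b), (liouville m : ℝ) := by
    rw [← Finset.sum_fiberwise_of_maps_to (s := (dyadic M).filter (fun m : ℕ => m.Coprime k))
      (t := (Finset.univ : Finset (ZMod k)).filter (fun b => IsUnit b)) (g := fun m : ℕ => (m : ZMod k))]
    · refine Finset.sum_congr rfl fun b hb => ?_
      rw [Finset.mem_filter] at hb
      rw [Finset.filter_filter]
      refine Finset.sum_congr (Finset.filter_congr fun m _ => ?_) fun _ _ => rfl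
      constructor
      · exact fun h => h.2
      · intro h
        refine ⟨?_, h⟩
        have hu : IsUnit ((m : ℕ) : ZMod k) := by rw [h]; exact hb.2
        exact (ZMod.isUnit_iff_coprime m k).mp hu
    · intro m hm
      rw [Finset.mem_filter] at hm
      exact Finset.mem_filter.mpr ⟨Finset.mem_univ _, (ZMod.isUnit_iff_coprime m k).mpr hm.2⟩
  have hcard : #((Finset.univ : Finset (ZMod k)).filter (fun b => IsUnit b)) = Nat.totient k := by
    have hset : (Finset.univ : Finset (ZMod k)).filter (fun b => IsUnit b) =
        (Finset.univ : Finset (ZMod k)ˣ).map ⟨Units.val, Units.val_injective⟩ := by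
      ext b
      simp only [Finset.mem_filter, Finset.mem_univ, true_and, Finset.mem_map,
        Function.Embedding.coeFn_mk]
      exact ⟨fun ⟨u, hu⟩ => ⟨u, hu⟩, fun ⟨u, hu⟩ => ⟨u, hu⟩⟩
    rw [hset, Finset.card_map, Finset.card_univ, ZMod.card_units_eq_totient]
  have hmean : |(∑ m ∈ (dyadic M).filter (fun m : ℕ => m.Coprime k), (liouville m : ℝ)) /
      (Nat.totient k : ℝ)| ≤ P := by
    rw [abs_div, abs_of_pos hφ, div_le_iff₀ hφ, hcop]
    refine (Finset.abs_sum_le_sum_abs _ _).trans ?_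
    calc ∑ b ∈ (Finset.univ : Finset (ZMod k)).filter (fun b => IsUnit b),
          |∑ m ∈ (dyadic M).filter (fun m : ℕ => (m : ZMod k) = b), (liouville m : ℝ)|
        ≤ ∑ _b ∈ (Finset.univ : Finset (ZMod k)).filter (fun b => IsUnit b), P :=
          Finset.sum_le_sum fun b _ => hP b
      _ = P * Nat.totient k := by rw [Finset.sum_const, hcard, nsmul_eq_mul, mul_comm]
  calc _ ≤ |∑ m ∈ (dyadic M).filter (fun m : ℕ => (m : ZMod k) = a), (liouville m : ℝ)| +
        |(∑ m ∈ (dyadic M).filter (fun m : ℕ => m.Coprime k), (liouville m : ℝ)) /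
          (Nat.totient k : ℝ)| := abs_sub _ _
    _ ≤ P + P := add_le_add (hP a) hmean
    _ = 2 * P := by ring


/-! ### Removing the coprimality condition `(n, d) = 1` -/

/-- **Möbius reduction of the (A₂)-discrepancy of `λ`.**  For `N ≥ 0`, `d, k ≥ 1`, `l` coprime to
`k`, and uniform bounds `|∑_{m ∼ N/e, m ≡ c (k)} λ(m)| ≤ P(e)` (`e ∣ d`, all `c`):
`|∑_{n ∼ N, n ≡ l (k), (n,d)=1} λ(n) − φ(k)⁻¹ ∑_{n ∼ N, (n,dk)=1} λ(n)| ≤ ∑_{e ∣ d} 2 P(e)`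
(`𝟙_{(n,d)=1} = ∑_{e ∣ (n,d)} μ(e)`, `n = em`, `λ(em) = λ(e)λ(m)`; divisors `e` not coprime to `k`
contribute nothing). -/
theorem abs_disc_liouville_le_sum_divisors {N : ℝ} (hN : 0 ≤ N) {d k : ℕ} (hd : 1 ≤ d) (hk : 1 ≤ k)
    {l : ℤ} (hl : IsCoprime (k : ℤ) l) {P : ℕ → ℝ}
    (hP : ∀ e ∈ d.divisors, ∀ c : ZMod k,
      |∑ m ∈ (dyadic (N / e)).filter (fun m : ℕ => (m : ZMod k) = c), (liouville m : ℝ)| ≤ P e) :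
    |(∑ n ∈ (dyadic N).filter (fun n : ℕ => (n : ZMod k) = (l : ZMod k) ∧ n.Coprime d),
        (liouville n : ℝ)) -
      (∑ n ∈ (dyadic N).filter (fun n : ℕ => n.Coprime (d * k)), (liouville n : ℝ)) /
        (Nat.totient k : ℝ)| ≤ ∑ e ∈ d.divisors, 2 * P e := by
  classical
  haveI : NeZero k := ⟨by omega⟩
  have hd0 : d ≠ 0 := by omega
  have hlu : IsUnit ((l : ZMod k)) := (ZMod.coe_int_isUnit_iff_isCoprime l k).mpr hl
  -- the class sum, opened over `e ∣ d`
  have hF : ∑ n ∈ (dyadic N).filter (fun n : ℕ => (n : ZMod k) = (l : ZMod k) ∧ n.Coprime d),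
      (liouville n : ℝ) =
      ∑ e ∈ d.divisors, (ArithmeticFunction.moebius e : ℝ) * ((liouville e : ℝ) *
        ∑ m ∈ (dyadic (N / e)).filter (fun m : ℕ => ((e : ZMod k)) * m = (l : ZMod k)),
          (liouville m : ℝ)) := by
    have h1 : (dyadic N).filter (fun n : ℕ => (n : ZMod k) = (l : ZMod k) ∧ n.Coprime d) =
        ((dyadic N).filter (fun n : ℕ => (n : ZMod k) = (l : ZMod k))).filter (fun n => n.Coprime d) := by
      rw [Finset.filter_filter]
    rw [h1, Polymath8a.sum_filter_coprime_eq_sum_divisors_moebius _ _ hd0]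
    refine Finset.sum_congr rfl fun e he => ?_
    have he1 : 1 ≤ e := Nat.pos_of_mem_divisors he
    congr 1
    rw [Finset.filter_filter]
    have h2 : (dyadic N).filter (fun n : ℕ => (n : ZMod k) = (l : ZMod k) ∧ e ∣ n) =
        (dyadic N).filter (fun n : ℕ => e ∣ n ∧ (n : ZMod k) = (l : ZMod k)) :=
      Finset.filter_congr fun n _ => and_comm
    rw [h2, sum_dyadic_filter_dvd_eq hN he1, Finset.mul_sum]
    refine Finset.sum_congr (Finset.filter_congr fun m _ => by push_cast; rfl) fun m _ => ?_
    rw [ArithmeticFunction.liouville_apply_mul]; push_cast; ring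
  -- the coprime sum, opened over `e ∣ d`
  have hG : ∑ n ∈ (dyadic N).filter (fun n : ℕ => n.Coprime (d * k)), (liouville n : ℝ) =
      ∑ e ∈ d.divisors, (ArithmeticFunction.moebius e : ℝ) * ((liouville e : ℝ) *
        ∑ m ∈ (dyadic (N / e)).filter (fun m : ℕ => (e * m).Coprime k), (liouville m : ℝ)) := by
    have h1 : (dyadic N).filter (fun n : ℕ => n.Coprime (d * k)) =
        ((dyadic N).filter (fun n : ℕ => n.Coprime k)).filter (fun n => n.Coprime d) := by
      rw [Finset.filter_filter]
      refine Finset.filter_congr fun n _ => ?_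
      rw [Nat.coprime_mul_iff_right]; tauto
    rw [h1, Polymath8a.sum_filter_coprime_eq_sum_divisors_moebius _ _ hd0]
    refine Finset.sum_congr rfl fun e he => ?_
    have he1 : 1 ≤ e := Nat.pos_of_mem_divisors he
    congr 1
    rw [Finset.filter_filter]
    have h2 : (dyadic N).filter (fun n : ℕ => n.Coprime k ∧ e ∣ n) =
        (dyadic N).filter (fun n : ℕ => e ∣ n ∧ n.Coprime k) :=
      Finset.filter_congr fun n _ => and_comm
    rw [h2, sum_dyadic_filter_dvd_eq hN he1, Finset.mul_sum]
    refine Finset.sum_congr rfl fun m _ => ?_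
    rw [ArithmeticFunction.liouville_apply_mul]; push_cast; ring
  -- termwise comparison
  have hφ : (0 : ℝ) < Nat.totient k := by exact_mod_cast Nat.totient_pos.mpr hk
  rw [hF, hG, Finset.sum_div, ← Finset.sum_sub_distrib]
  refine (Finset.abs_sum_le_sum_abs _ _).trans (Finset.sum_le_sum fun e he => ?_)
  have hP0 : 0 ≤ P e := le_trans (abs_nonneg _) (hP e he 0)
  have hml : |(ArithmeticFunction.moebius e : ℝ) * (liouville e : ℝ)| ≤ 1 := by
    rw [abs_mul]
    have h1 : |(ArithmeticFunction.moebius e : ℝ)| ≤ 1 := by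
      exact_mod_cast ArithmeticFunction.abs_moebius_le_one
    have h2 : |(liouville e : ℝ)| ≤ 1 := by
      exact Literature.NumberTheory.LFunctions.LiouvilleSum.abs_liouville_le_one e
    nlinarith [abs_nonneg (ArithmeticFunction.moebius e : ℝ), abs_nonneg (liouville e : ℝ)]
  by_cases hek : (e : ℕ).Coprime k
  · -- `e` is a unit mod `k`
    have heu : IsUnit ((e : ℕ) : ZMod k) := (ZMod.isUnit_iff_coprime e k).mpr hek
    obtain ⟨u, hu⟩ := heu
    have hA : (dyadic (N / e)).filter (fun m : ℕ => ((e : ZMod k)) * m = (l : ZMod k)) =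
        (dyadic (N / e)).filter (fun m : ℕ => (m : ZMod k) = (u⁻¹ : (ZMod k)ˣ) * (l : ZMod k)) := by
      refine Finset.filter_congr fun m _ => ?_
      rw [← hu]
      constructor
      · intro h; rw [← h, ← mul_assoc, Units.inv_mul, one_mul]
      · intro h; rw [h, ← mul_assoc, Units.mul_inv, one_mul]
    have hB : (dyadic (N / e)).filter (fun m : ℕ => (e * m).Coprime k) =
        (dyadic (N / e)).filter (fun m : ℕ => m.Coprime k) := by
      refine Finset.filter_congr fun m _ => ?_
      rw [Nat.coprime_mul_iff_left]
      exact ⟨fun h => h.2, fun h => ⟨hek, h⟩⟩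
    rw [hA, hB]
    have hmain := abs_class_sub_mean_le (M := N / e) hk (fun c => hP e he c)
      ((u⁻¹ : (ZMod k)ˣ) * (l : ZMod k))
    calc |(ArithmeticFunction.moebius e : ℝ) * ((liouville e : ℝ) * _) -
          (ArithmeticFunction.moebius e : ℝ) * ((liouville e : ℝ) * _) / (Nat.totient k : ℝ)|
        = |(ArithmeticFunction.moebius e : ℝ) * (liouville e : ℝ)| *
            |(∑ m ∈ (dyadic (N / e)).filter
                (fun m : ℕ => (m : ZMod k) = (u⁻¹ : (ZMod k)ˣ) * (l : ZMod k)), (liouville m : ℝ)) -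
              (∑ m ∈ (dyadic (N / e)).filter (fun m : ℕ => m.Coprime k), (liouville m : ℝ)) /
                (Nat.totient k : ℝ)| := by
          rw [← abs_mul]; congr 1; ring
      _ ≤ 1 * (2 * P e) := mul_le_mul hml hmain (abs_nonneg _) zero_le_one
      _ = 2 * P e := one_mul _
  · -- `e` not coprime to `k`: both inner sums vanish
    have hA : (dyadic (N / e)).filter (fun m : ℕ => ((e : ZMod k)) * m = (l : ZMod k)) = ∅ := by
      refine Finset.filter_eq_empty_iff.mpr fun m _ h => hek ?_
      have : IsUnit (((e : ℕ) : ZMod k) * m) := by rw [h]; exact hlu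
      exact (ZMod.isUnit_iff_coprime e k).mp (isUnit_of_mul_isUnit_left this)
    have hB : (dyadic (N / e)).filter (fun m : ℕ => (e * m).Coprime k) = ∅ := by
      refine Finset.filter_eq_empty_iff.mpr fun m _ h => hek ?_
      exact Nat.Coprime.coprime_mul_right h
    rw [hA, hB]
    simp only [Finset.sum_empty, mul_zero, zero_div, sub_zero, abs_zero]
    linarith


/-! ### Elementary size facts -/

/-- `(log 2N)^{c} ≤ (2c)^{c} √(2N)` for `c ≥ 1/2`, `N ≥ 1/2` (`log y ≤ y^ε/ε`). -/
theorem log_rpow_le_sqrt {N c : ℝ} (hN : 1 / 2 ≤ N) (hc : 1 / 2 ≤ c) :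
    Real.log (2 * N) ^ c ≤ (2 * c) ^ c * Real.sqrt (2 * N) := by
  have h2N : 1 ≤ 2 * N := by linarith
  have hl0 : 0 ≤ Real.log (2 * N) := Real.log_nonneg h2N
  have hc0 : 0 < c := by linarith
  have hε : 0 < 1 / (2 * c) := by positivity
  have h1 : Real.log (2 * N) ≤ (2 * N) ^ (1 / (2 * c)) / (1 / (2 * c)) :=
    Real.log_le_rpow_div (by linarith) hε
  rw [div_div_eq_mul_div, div_one] at h1
  have h2 : Real.log (2 * N) ^ c ≤ ((2 * N) ^ (1 / (2 * c)) * (2 * c)) ^ c :=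
    Real.rpow_le_rpow hl0 h1 hc0.le
  refine h2.trans (le_of_eq ?_)
  rw [Real.mul_rpow (by positivity) (by positivity), ← Real.rpow_mul (by linarith),
    show 1 / (2 * c) * c = 1 / 2 by field_simp, Real.sqrt_eq_rpow]
  ring

/-- `‖λ‖²` over `n ∼ N` is `#{n ∼ N} ≥ N/2` (`N ≥ 2`). -/
theorem l2Sq_liouville_ge {N : ℝ} (hN : 2 ≤ N) :
    N / 2 ≤ l2Sq N (fun n => (liouville n : ℝ)) := by
  have hN0 : 0 ≤ N := by linarith
  have h1 : l2Sq N (fun n => (liouville n : ℝ)) = #(dyadic N) := by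
    unfold l2Sq
    rw [Finset.card_eq_sum_ones, Nat.cast_sum, Nat.cast_one]
    refine Finset.sum_congr rfl fun n hn => ?_
    have hn0 : n ≠ 0 := (pos_of_mem_dyadic hN0 hn).ne'
    dsimp only
    rw [ArithmeticFunction.liouville_apply hn0]
    push_cast
    rw [← pow_mul, mul_comm, pow_mul]; norm_num
  rw [h1, dyadic_eq_Ioc hN0, Nat.card_Ioc]
  have h2 : (⌊N⌋₊ : ℝ) ≤ N := Nat.floor_le hN0
  have h3 : 2 * N - 1 < (⌊2 * N⌋₊ : ℝ) := by
    have := Nat.lt_floor_add_one (2 * N); linarith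
  have h4 : ⌊N⌋₊ ≤ ⌊2 * N⌋₊ := Nat.floor_mono (by linarith)
  rw [Nat.cast_sub h4]; linarith

end Summit.Parity.GeneralizedHardyLittlewood.Theorems
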